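import Summits.CriticalPhenomena.PercolationContinuityZ3.Theorems.PercNearOneGluingNoHeavyLowerTailSahiGridPatternCoCountProductNCrossed

/-!
# `NoHeavyLowerTail` (crux stmt-CriticalPhenomena-4575), Sahi programme P1: **CONJECTURE A FOR `x ∨ y` AT THE ALIGNED CROSSED PAIRS — every `k`,
# every certificate** (the family of generation 41's "principal defect rectangle" instances, on which no `V`-independent routing exists)

Support file (Sahi cell, seat `prim-sahi-p1`, generation 42; `--supports stmt-CriticalPhenomena-4575`).  Pure proofs, no definitions, no `sorry`, standard axioms.
Vocabulary of `…SahiGridPattern{,DiagCert,CoCountProductNProduct,CoCountProductNCrossed,HarrisEquality}`.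

THE MATHEMATICS (seat memo FROM-prim-sahi-p1-gen42 §7).  Inner block `V = ↑a ∪ ↑b ⊆ [3]^k`, the union of two principal up-sets with DISJOINT SUPPORTS
(`a` vanishes off a coordinate set `Sx`, `b` vanishes on `Sx`); crossed test pair with `A₀ = ↑a'` (`a' ≥ a`), `B = ↑b`, `B′ = ↑β` (`β ≥ b`), so that the footprint is
`F = A₀ ∩ B′ = ↑f`, `f = a' ∨ β`.  By `diagCert_coProduct_N_orTwo_crossed` (generation 42) condition (N) of the co-count product at the crossed pair needs only
`3·d_V(F) + (three Harris slacks ≥ 0) ≥ 3·2^k·#F + 2κ′_V(A₀,B′)`.  THE SPLIT ROW: let `u = f·1_{Sx}`, `w = f·1_{Sxᶜ}`; then `↑u ∩ ↑w = F`, `↑u, ↑w ⊆ V`, and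
`↑u ⊥ ↑w` (complementary coordinates), so condition (N) for `V` at `(↑u, ↑w)` reads
    `d_V(F) ≥ Θ_V(↑u × ↑w) = 2·N(↑u;↑w) − M_V(↑u,↑w) = 2^k·#F + #{(q,r) ∈ ↑u×↑w : q δ̸ r, q̄r ∉ V}`     (Harris EQUALITY `N(↑u;↑w) = 2^k#F`),
while `κ′_V(A₀,B′) = #{(q,r) ∈ ↑a'×↑β : q δ̸ r, q̄r ∉ V}` (as `↑a' ⊆ V`).  THE INJECTION (`pairThird_sum_le_split`): swapping the two points on the coordinates
`J = {i ∈ Sx : a'_i < β_i} ∪ {i ∉ Sx : β_i < a'_i}` is an involution of `[3]^k × [3]^k` that preserves total distinctness and the third point and maps `↑a' × ↑β`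
into `↑u × ↑w`; hence `κ′ ≤ gain` for EVERY `V` (indeed for every nonnegative weight of the third point), and the crossed inequality holds with room `κ′ + h_V(B′,A₀)`.
* `pairThird_sum_le_split` — the injection inequality (any nonnegative weight `φ` of the third point; any `a', β`, any `Sx`).
* `diagCert_coProduct_N_orTwo_crossed_aligned` — ★ (N) of the co-count product `(x∨y, c) ⊗ (V, d_V)` at every aligned crossed pair, for every `k`, every such
  `a, b, a', β` and EVERY `d_V` satisfying (N) for `V`;  `sStarD_blockAnd_orTwo_crossed_aligned_nonneg` — with (T): `0 ≤ sStarD ((x∨y)×V) P Q` there.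
At `k = 2` these pairs include generation 41's word-menu counterexamples (`V = ↑02 ∪ ↑10`, `A₀ = ↑10`, `B′ = ↑22 ⊂ B = ↑02`: split row `(↑20, ↑02)`).
Nothing in this file asserts Conjecture A in general or `PatternPos d` for `d ≥ 4`. [this work]
-/

namespace Summit.CriticalPhenomena.PercolationContinuityZ3.Theorems.SahiGridPattern

open Finset SahiGrid3
open scoped BigOperators

section AlignedTools

variable {k : ℕ}

/-- Membership in a principal up-set given by a membership hypothesis is upward closed. [this work] -/
theorem isUpperSet_of_mem_iff_le {X : Finset (Pd k)} {x : Pd k} (hX : ∀ q, q ∈ X ↔ x ≤ q) : IsUpperSet (X : Set (Pd k)) := by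
  intro q r hqr hq
  rw [Finset.mem_coe, hX] at hq ⊢
  exact le_trans hq hqr

/-- The union of two principal up-sets (given by a membership hypothesis) is upward closed. [this work] -/
theorem isUpperSet_of_mem_iff_le_or {X : Finset (Pd k)} {x x' : Pd k} (hX : ∀ q, q ∈ X ↔ (x ≤ q ∨ x' ≤ q)) : IsUpperSet (X : Set (Pd k)) := by
  intro q r hqr hq
  rw [Finset.mem_coe, hX] at hq ⊢
  rcases hq with h | h
  · exact Or.inl (le_trans h hqr)
  · exact Or.inr (le_trans h hqr)

/-- **The injection inequality.**  For `a', β ∈ [3]^k`, a coordinate set `Sx`, `u = (a'∨β)·1_{Sx}`, `w = (a'∨β)·1_{Sxᶜ}` and any nonnegative weight `φ`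
of the third point: `Σ_{q ≥ a', r ≥ β, q δ̸ r} φ(q̄r) ≤ Σ_{q ≥ u, r ≥ w, q δ̸ r} φ(q̄r)` — swap the two points on the coordinates where the target
rectangle requires it; the swap is an involution preserving `δ̸` and the third point. [this work] -/
theorem pairThird_sum_le_split {A0 Bp U W : Finset (Pd k)} {a' β u w : Pd k} {Sx : Finset (Fin k)}
    (hA0 : ∀ q, q ∈ A0 ↔ a' ≤ q) (hBp : ∀ q, q ∈ Bp ↔ β ≤ q) (hU : ∀ q, q ∈ U ↔ u ≤ q) (hW : ∀ q, q ∈ W ↔ w ≤ q)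
    (huS : ∀ i, i ∈ Sx → u i = max (a' i) (β i)) (huS' : ∀ i, i ∉ Sx → u i = 0)
    (hwS : ∀ i, i ∈ Sx → w i = 0) (hwS' : ∀ i, i ∉ Sx → w i = max (a' i) (β i))
    (φ : Pd k → ℤ) (hφ : ∀ s, 0 ≤ φ s) :
    (∑ q : Pd k, ∑ r : Pd k, ind A0 q * ind Bp r * (if TotDist q r = true then (1:ℤ) else 0) * φ (thirdPt q r))
      ≤ ∑ q : Pd k, ∑ r : Pd k, ind U q * ind W r * (if TotDist q r = true then (1:ℤ) else 0) * φ (thirdPt q r) := by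
  classical
  -- the swap set and the mixing involution on pairs
  set J : Finset (Fin k) := univ.filter (fun i => (i ∈ Sx ∧ a' i < β i) ∨ (i ∉ Sx ∧ β i < a' i)) with hJ
  let σ : Pd k × Pd k → Pd k × Pd k := fun p =>
    (fun i => if i ∈ J then p.2 i else p.1 i, fun i => if i ∈ J then p.1 i else p.2 i)
  have hσσ : Function.Involutive σ := by
    intro p
    obtain ⟨q, r⟩ := p
    simp only [σ, Prod.mk.injEq]
    refine ⟨?_, ?_⟩ <;> (funext i; by_cases hi : i ∈ J <;> simp [hi])
  let e : (Pd k × Pd k) ≃ (Pd k × Pd k) := hσσ.toPerm σ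
  -- pointwise facts about σ
  have hthird : ∀ q r : Pd k, thirdPt (σ (q, r)).1 (σ (q, r)).2 = thirdPt q r := by
    intro q r
    funext i
    simp only [σ, thirdPt]
    by_cases hi : i ∈ J
    · simp only [hi, if_true]; rw [add_comm]
    · simp only [hi, if_false]
  have htd : ∀ q r : Pd k, TotDist (σ (q, r)).1 (σ (q, r)).2 = TotDist q r := by
    intro q r
    have h1 : (TotDist (σ (q, r)).1 (σ (q, r)).2 = true) ↔ (TotDist q r = true) := by
      rw [totDist_iff, totDist_iff]
      constructor
      · intro h i
        have hi := h i
        simp only [σ] at hi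
        by_cases hJ' : i ∈ J
        · simp only [hJ', if_true] at hi; exact fun hqr => hi hqr.symm
        · simp only [hJ', if_false] at hi; exact hi
      · intro h i
        simp only [σ]
        by_cases hJ' : i ∈ J
        · simp only [hJ', if_true]; exact fun hrq => h i hrq.symm
        · simp only [hJ', if_false]; exact h i
    by_cases hq : TotDist q r = true
    · rw [hq]; exact h1.2 hq
    · have hq' : TotDist q r = false := by simpa using hq
      rw [hq']
      by_contra hc
      have hc' : TotDist (σ (q, r)).1 (σ (q, r)).2 = true := by simpa using hc
      exact hq (h1.1 hc')
  have hmemU : ∀ q r : Pd k, q ∈ A0 → r ∈ Bp → (σ (q, r)).1 ∈ U := by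
    intro q r hq hr
    rw [hA0] at hq; rw [hBp] at hr; rw [hU]
    intro i
    simp only [σ]
    by_cases hi : i ∈ Sx
    · rw [huS i hi]
      by_cases hJ' : i ∈ J
      · simp only [hJ', if_true]
        have hlt : a' i < β i := by
          have := (Finset.mem_filter.1 hJ').2
          rcases this with ⟨_, h⟩ | ⟨h, _⟩
          · exact h
          · exact absurd hi h
        rw [max_eq_right (le_of_lt hlt)]; exact hr i
      · simp only [hJ', if_false]
        have hle : β i ≤ a' i := le_of_not_gt fun hc => hJ' (Finset.mem_filter.2 ⟨Finset.mem_univ _, Or.inl ⟨hi, hc⟩⟩)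
        rw [max_eq_left hle]; exact hq i
    · rw [huS' i hi]
      by_cases hJ' : i ∈ J
      · simp only [hJ', if_true]; exact Fin.zero_le _
      · simp only [hJ', if_false]; exact Fin.zero_le _
  have hmemW : ∀ q r : Pd k, q ∈ A0 → r ∈ Bp → (σ (q, r)).2 ∈ W := by
    intro q r hq hr
    rw [hA0] at hq; rw [hBp] at hr; rw [hW]
    intro i
    simp only [σ]
    by_cases hi : i ∈ Sx
    · rw [hwS i hi]
      by_cases hJ' : i ∈ J
      · simp only [hJ', if_true]; exact Fin.zero_le _
      · simp only [hJ', if_false]; exact Fin.zero_le _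
    · rw [hwS' i hi]
      by_cases hJ' : i ∈ J
      · simp only [hJ', if_true]
        have hlt : β i < a' i := by
          have := (Finset.mem_filter.1 hJ').2
          rcases this with ⟨h, _⟩ | ⟨_, h⟩
          · exact absurd h hi
          · exact h
        rw [max_eq_left (le_of_lt hlt)]; exact hq i
      · simp only [hJ', if_false]
        have hle : a' i ≤ β i := le_of_not_gt fun hc => hJ' (Finset.mem_filter.2 ⟨Finset.mem_univ _, Or.inr ⟨hi, hc⟩⟩)
        rw [max_eq_right hle]; exact hr i
  -- the two sums as sums over pairs, the second re-indexed by σ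
  let F : Pd k → Pd k → ℤ := fun q r => ind A0 q * ind Bp r * (if TotDist q r = true then (1:ℤ) else 0) * φ (thirdPt q r)
  let G : Pd k → Pd k → ℤ := fun q r => ind U q * ind W r * (if TotDist q r = true then (1:ℤ) else 0) * φ (thirdPt q r)
  have hL : (∑ q : Pd k, ∑ r : Pd k, ind A0 q * ind Bp r * (if TotDist q r = true then (1:ℤ) else 0) * φ (thirdPt q r))
      = ∑ p : Pd k × Pd k, F p.1 p.2 := (Fintype.sum_prod_type' F).symm
  have hR0 : (∑ q : Pd k, ∑ r : Pd k, ind U q * ind W r * (if TotDist q r = true then (1:ℤ) else 0) * φ (thirdPt q r))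
      = ∑ p : Pd k × Pd k, G p.1 p.2 := (Fintype.sum_prod_type' G).symm
  have hR : (∑ p : Pd k × Pd k, G p.1 p.2) = ∑ p : Pd k × Pd k, G (e p).1 (e p).2 :=
    (Equiv.sum_comp e (fun p => G p.1 p.2)).symm
  rw [hL, hR0, hR]
  refine Finset.sum_le_sum fun p _ => ?_
  obtain ⟨q, r⟩ := p
  have he : e (q, r) = σ (q, r) := rfl
  rw [he]
  show ind A0 q * ind Bp r * (if TotDist q r = true then (1:ℤ) else 0) * φ (thirdPt q r)
      ≤ ind U (σ (q, r)).1 * ind W (σ (q, r)).2 * (if TotDist (σ (q, r)).1 (σ (q, r)).2 = true then (1:ℤ) else 0) * φ (thirdPt (σ (q, r)).1 (σ (q, r)).2)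
  rw [hthird q r, htd q r]
  have ht0 : 0 ≤ (if TotDist q r = true then (1:ℤ) else 0) := by split_ifs <;> norm_num
  have hrhs0 : 0 ≤ ind U (σ (q, r)).1 * ind W (σ (q, r)).2 * (if TotDist q r = true then (1:ℤ) else 0) * φ (thirdPt q r) :=
    mul_nonneg (mul_nonneg (mul_nonneg (ind_nonneg' U (σ (q, r)).1) (ind_nonneg' W (σ (q, r)).2)) ht0) (hφ (thirdPt q r))
  by_cases hq : q ∈ A0
  · by_cases hr : r ∈ Bp
    · have h1 : ind A0 q = 1 := by unfold ind; rw [if_pos hq]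
      have h2 : ind Bp r = 1 := by unfold ind; rw [if_pos hr]
      have h3 : ind U (σ (q, r)).1 = 1 := by unfold ind; rw [if_pos (hmemU q r hq hr)]
      have h4 : ind W (σ (q, r)).2 = 1 := by unfold ind; rw [if_pos (hmemW q r hq hr)]
      rw [h1, h2, h3, h4]
    · have h2 : ind Bp r = 0 := by unfold ind; rw [if_neg hr]
      rw [h2, mul_zero, zero_mul, zero_mul]
      exact hrhs0
  · have h1 : ind A0 q = 0 := by unfold ind; rw [if_neg hq]
    rw [h1, zero_mul, zero_mul, zero_mul]
    exact hrhs0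

end AlignedTools

section AlignedMain

variable {k : ℕ} {S Fx Gy : Finset (Pd (1 + 1))} {V : Finset (Pd k)} {A : Finset (Pd ((1 + 1) + k))}

/-- **THEOREM (Conjecture A for `x ∨ y` at the ALIGNED crossed pairs; every `k`, every certificate).**
`S = {x≥1} ∨ {y≥1}` (`hS`) with its recursive certificate `dS` (`hdS`), `A = S × V` (`hA`); inner block `V = ↑a ∪ ↑b` (`hVm`) with `a` supported on the
coordinate set `Sx` and `b` supported off `Sx` (`haS`, `hbS`); `d_V ≥ 0` satisfying (N) for `V`; `A₀ = ↑a'` with `a ≤ a'`, `B = ↑b`, `B′ = ↑β` with `b ≤ β`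
(membership hypotheses); the split points `u = (a'∨β)·1_{Sx}`, `w = (a'∨β)·1_{Sxᶜ}` and their principal up-sets `U, W`; the crossed pair `P = Fx × A₀`,
`Q = {q ∈ B′} ∪ (Gy × B)`.  Then the co-count product satisfies (N) at `(P, Q)` — for EVERY `d_V` satisfying (N) for `V` (no sign or (T) hypothesis needed). [this work] -/
theorem diagCert_coProduct_N_orTwo_crossed_aligned (hS : ∀ ξ η : Pd 1, glue ξ η ∈ S ↔ (1 ≤ ξ 0 ∨ 1 ≤ η 0))
    (hFx : ∀ ξ η : Pd 1, glue ξ η ∈ Fx ↔ 1 ≤ ξ 0) (hGy : ∀ ξ η : Pd 1, glue ξ η ∈ Gy ↔ 1 ≤ η 0)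
    (hA : ∀ σ z, glue σ z ∈ A ↔ (σ ∈ S ∧ z ∈ V))
    (dS : Pd (1 + 1) → ℤ) (hdS : dS (glue (fun _ => 0) (fun _ => 0)) = 0 ∧ dS (glue (fun _ => 0) (fun _ => 1)) = 4 ∧ dS (glue (fun _ => 0) (fun _ => 2)) = 4 ∧
      dS (glue (fun _ => 1) (fun _ => 0)) = 2 ∧ dS (glue (fun _ => 1) (fun _ => 1)) = 5 ∧ dS (glue (fun _ => 1) (fun _ => 2)) = 5 ∧
      dS (glue (fun _ => 2) (fun _ => 0)) = 2 ∧ dS (glue (fun _ => 2) (fun _ => 1)) = 5 ∧ dS (glue (fun _ => 2) (fun _ => 2)) = 5)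
    {a b a' β u w : Pd k} {Sx : Finset (Fin k)} (hVm : ∀ q, q ∈ V ↔ (a ≤ q ∨ b ≤ q))
    (haS : ∀ i, i ∉ Sx → a i = 0) (hbS : ∀ i, i ∈ Sx → b i = 0) (haa : a ≤ a') (hbb : b ≤ β)
    (huS : ∀ i, i ∈ Sx → u i = max (a' i) (β i)) (huS' : ∀ i, i ∉ Sx → u i = 0)
    (hwS : ∀ i, i ∈ Sx → w i = 0) (hwS' : ∀ i, i ∉ Sx → w i = max (a' i) (β i))
    {A0 Bp B0 U W : Finset (Pd k)} (hA0 : ∀ q, q ∈ A0 ↔ a' ≤ q) (hBp : ∀ q, q ∈ Bp ↔ β ≤ q) (hB0 : ∀ q, q ∈ B0 ↔ b ≤ q)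
    (hU : ∀ q, q ∈ U ↔ u ≤ q) (hW : ∀ q, q ∈ W ↔ w ≤ q)
    (dV : Pd k → ℤ)
    (hNV : ∀ X X' : Finset (Pd k), IsUpperSet (X : Set (Pd k)) → IsUpperSet (X' : Set (Pd k)) → (∑ q ∈ X, ∑ r ∈ X', thetaVal V q r) ≤ ∑ q ∈ X ∩ X', dV q)
    {P Q : Finset (Pd ((1 + 1) + k))} (hP : ∀ σ q, glue σ q ∈ P ↔ (σ ∈ Fx ∧ q ∈ A0)) (hQ : ∀ σ q, glue σ q ∈ Q ↔ (q ∈ Bp ∨ (σ ∈ Gy ∧ q ∈ B0))) :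
    (∑ x ∈ P, ∑ y ∈ Q, thetaVal A x y) ≤ ∑ x ∈ P ∩ Q, (2 * (2:ℤ) ^ ((1 + 1) + k) * (ind S (freeOf x) * ind V (cellOf x))
        - (2 * (2:ℤ) ^ (1 + 1) * ind S (freeOf x) - dS (freeOf x)) * (2 * (2:ℤ) ^ k * ind V (cellOf x) - dV (cellOf x))) := by
  -- up-sets
  have hVu : IsUpperSet (V : Set (Pd k)) := isUpperSet_of_mem_iff_le_or hVm
  have hA0u : IsUpperSet (A0 : Set (Pd k)) := isUpperSet_of_mem_iff_le hA0
  have hBpu : IsUpperSet (Bp : Set (Pd k)) := isUpperSet_of_mem_iff_le hBp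
  have hB0u : IsUpperSet (B0 : Set (Pd k)) := isUpperSet_of_mem_iff_le hB0
  have hUu : IsUpperSet (U : Set (Pd k)) := isUpperSet_of_mem_iff_le hU
  have hWu : IsUpperSet (W : Set (Pd k)) := isUpperSet_of_mem_iff_le hW
  have hsub : Bp ⊆ B0 := fun q hq => (hB0 q).2 (le_trans hbb ((hBp q).1 hq))
  -- coordinatewise comparisons
  have hau : a ≤ u := by
    intro i
    by_cases hi : i ∈ Sx
    · rw [huS i hi]; exact le_trans (haa i) (le_max_left _ _)
    · rw [haS i hi]; exact Fin.zero_le _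
  have hbw : b ≤ w := by
    intro i
    by_cases hi : i ∈ Sx
    · rw [hbS i hi]; exact Fin.zero_le _
    · rw [hwS' i hi]; exact le_trans (hbb i) (le_max_right _ _)
  have hUV : ∀ q, q ∈ U → q ∈ V := fun q hq => (hVm q).2 (Or.inl (le_trans hau ((hU q).1 hq)))
  have hWV : ∀ q, q ∈ W → q ∈ V := fun q hq => (hVm q).2 (Or.inr (le_trans hbw ((hW q).1 hq)))
  have hA0V : ∀ q, q ∈ A0 → q ∈ V := fun q hq => (hVm q).2 (Or.inl (le_trans haa ((hA0 q).1 hq)))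
  -- the footprint: U ∩ W = A0 ∩ Bp (both are ↑(a' ∨ β))
  have hUW : ∀ q, (q ∈ U ∧ q ∈ W) ↔ (q ∈ A0 ∧ q ∈ Bp) := by
    intro q
    rw [hU, hW, hA0, hBp]
    constructor
    · rintro ⟨h1, h2⟩
      refine ⟨fun i => ?_, fun i => ?_⟩
      · by_cases hi : i ∈ Sx
        · have := h1 i; rw [huS i hi] at this; exact le_trans (le_max_left _ _) this
        · have := h2 i; rw [hwS' i hi] at this; exact le_trans (le_max_left _ _) this
      · by_cases hi : i ∈ Sx
        · have := h1 i; rw [huS i hi] at this; exact le_trans (le_max_right _ _) this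
        · have := h2 i; rw [hwS' i hi] at this; exact le_trans (le_max_right _ _) this
    · rintro ⟨h1, h2⟩
      refine ⟨fun i => ?_, fun i => ?_⟩
      · by_cases hi : i ∈ Sx
        · rw [huS i hi]; exact max_le (h1 i) (h2 i)
        · rw [huS' i hi]; exact Fin.zero_le _
      · by_cases hi : i ∈ Sx
        · rw [hwS i hi]; exact Fin.zero_le _
        · rw [hwS' i hi]; exact max_le (h1 i) (h2 i)
  have hUWeq : U ∩ W = A0 ∩ Bp := by
    ext q
    rw [Finset.mem_inter, Finset.mem_inter]
    exact hUW q
  -- independence of U and W (complementary coordinates) ⟹ Harris equality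
  have hUdep : ∀ x y : Pd k, (∀ i ∈ Sx, x i = y i) → (x ∈ U ↔ y ∈ U) := by
    intro x y hxy
    rw [hU, hU]
    constructor
    · intro h i
      by_cases hi : i ∈ Sx
      · rw [← hxy i hi]; exact h i
      · rw [huS' i hi]; exact Fin.zero_le _
    · intro h i
      by_cases hi : i ∈ Sx
      · rw [hxy i hi]; exact h i
      · rw [huS' i hi]; exact Fin.zero_le _
  have hWdep : ∀ x y : Pd k, (∀ i ∉ Sx, x i = y i) → (x ∈ W ↔ y ∈ W) := by
    intro x y hxy
    rw [hW, hW]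
    constructor
    · intro h i
      by_cases hi : i ∈ Sx
      · rw [hwS i hi]; exact Fin.zero_le _
      · rw [← hxy i hi]; exact h i
    · intro h i
      by_cases hi : i ∈ Sx
      · rw [hwS i hi]; exact Fin.zero_le _
      · rw [hxy i hi]; exact h i
  have hHarrisEq : (∑ p : Pd k, ∑ q : Pd k, ind U p * ind W q * (if TotDist p q = true then (1:ℤ) else 0)) = 2 ^ k * ∑ p : Pd k, ind U p * ind W p :=
    (harrisSlack_eq_zero_iff U W hUu hWu).2 ⟨Sx, hUdep, hWdep⟩
  -- names
  set tV : Pd k → Pd k → ℤ := fun q r => if TotDist q r = true then (1:ℤ) else 0 with htV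
  set a1 : ℤ := ∑ q : Pd k, ∑ r : Pd k, ind A0 q * ind B0 r * tV q r * ind V q with ha1
  set a2 : ℤ := ∑ q : Pd k, ∑ r : Pd k, ind A0 q * ind B0 r * tV q r * ind V r with ha2
  set b1 : ℤ := ∑ q : Pd k, ∑ r : Pd k, ind A0 q * ind Bp r * tV q r * ind V q with hb1
  set b2 : ℤ := ∑ q : Pd k, ∑ r : Pd k, ind A0 q * ind Bp r * tV q r * ind V r with hb2
  set mb : ℤ := ∑ q : Pd k, ∑ r : Pd k, ind A0 q * ind Bp r * tV q r * ind V (thirdPt q r) with hmb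
  set nB : ℤ := ∑ q : Pd k, ind A0 q * ind B0 q * ind V q with hnB
  set nBp : ℤ := ∑ q : Pd k, ind A0 q * ind Bp q * ind V q with hnBp
  set yBp : ℤ := ∑ q : Pd k, ind A0 q * ind Bp q * dV q with hyBp
  set cU1 : ℤ := ∑ q : Pd k, ∑ r : Pd k, ind U q * ind W r * tV q r * ind V q with hcU1
  set cU2 : ℤ := ∑ q : Pd k, ∑ r : Pd k, ind U q * ind W r * tV q r * ind V r with hcU2
  set mU : ℤ := ∑ q : Pd k, ∑ r : Pd k, ind U q * ind W r * tV q r * ind V (thirdPt q r) with hmU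
  set ntd : ℤ := ∑ q : Pd k, ∑ r : Pd k, ind U q * ind W r * tV q r with hntd
  -- Harris / Kleitman slacks
  have hH1 : a1 ≤ 2 ^ k * nB := pairCount_le_harris hVu hA0u hB0u
  have hH2 : a2 ≤ 2 ^ k * nB := pairCount_le_harris' hVu hA0u hB0u
  have hH3 : b2 ≤ 2 ^ k * nBp := pairCount_le_harris' hVu hA0u hBpu
  have hK : mb ≤ b1 := latCount_le_pairCount hVu hA0u
  -- cU1 = cU2 = ntd (U, W ⊆ V) and b1 = Σ 1_{A0}1_{Bp} t (A0 ⊆ V)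
  have hindV : ∀ (X : Finset (Pd k)), (∀ q, q ∈ X → q ∈ V) → ∀ q, ind X q * ind V q = ind X q := by
    intro X hX q
    unfold ind
    by_cases hq : q ∈ X
    · rw [if_pos hq, if_pos (hX q hq)]; ring
    · rw [if_neg hq]; ring
  have hc1 : cU1 = ntd := by
    rw [hcU1, hntd]
    refine Finset.sum_congr rfl fun q _ => Finset.sum_congr rfl fun r _ => ?_
    have := hindV U hUV q
    calc ind U q * ind W r * tV q r * ind V q = (ind U q * ind V q) * ind W r * tV q r := by ring
      _ = ind U q * ind W r * tV q r := by rw [this]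
  have hc2 : cU2 = ntd := by
    rw [hcU2, hntd]
    refine Finset.sum_congr rfl fun q _ => Finset.sum_congr rfl fun r _ => ?_
    have := hindV W hWV r
    calc ind U q * ind W r * tV q r * ind V r = ind U q * (ind W r * ind V r) * tV q r := by ring
      _ = ind U q * ind W r * tV q r := by rw [this]
  have hb1' : b1 = ∑ q : Pd k, ∑ r : Pd k, ind A0 q * ind Bp r * tV q r := by
    rw [hb1]
    refine Finset.sum_congr rfl fun q _ => Finset.sum_congr rfl fun r _ => ?_
    have := hindV A0 hA0V q
    calc ind A0 q * ind Bp r * tV q r * ind V q = (ind A0 q * ind V q) * ind Bp r * tV q r := by ring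
      _ = ind A0 q * ind Bp r * tV q r := by rw [this]
  -- ntd = 2^k nBp
  have hnn : (∑ p : Pd k, ind U p * ind W p) = nBp := by
    rw [hnBp]
    refine Finset.sum_congr rfl fun q _ => ?_
    have e1 : ind U q * ind W q = ind (U ∩ W) q := (ind_inter_eq_mul U W q).symm
    have e2 : ind A0 q * ind Bp q = ind (A0 ∩ Bp) q := (ind_inter_eq_mul A0 Bp q).symm
    rw [e1, hUWeq, ← hindV (A0 ∩ Bp) (fun q hq => hA0V q (Finset.mem_inter.1 hq).1) q, ← e2]
  have hntd_eq : ntd = 2 ^ k * nBp := by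
    rw [hntd, ← hnn, ← hHarrisEq]
  -- the split row (N_V) at (U,W)
  have hrow : cU1 + cU2 - mU ≤ yBp := by
    have h := hNV U W hUu hWu
    rw [theta_rect_eq_counts V U W, hUWeq] at h
    have e : (∑ q ∈ A0 ∩ Bp, dV q) = yBp := by
      rw [hyBp, sum_mem_eq_sum_ind_mul (A0 ∩ Bp)]
      refine Finset.sum_congr rfl fun q _ => ?_
      rw [ind_inter_eq_mul]
    rw [e] at h
    exact h
  -- the injection: b1 − mb ≤ ntd − mU
  have hinj : b1 - mb ≤ ntd - mU := by
    have h := pairThird_sum_le_split hA0 hBp hU hW huS huS' hwS hwS' (fun s => 1 - ind V s)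
      (fun s => by unfold ind; split_ifs <;> norm_num)
    have e1 : (∑ q : Pd k, ∑ r : Pd k, ind A0 q * ind Bp r * (if TotDist q r = true then (1:ℤ) else 0) * (1 - ind V (thirdPt q r))) = b1 - mb := by
      rw [hb1', hmb, ← Finset.sum_sub_distrib]
      refine Finset.sum_congr rfl fun q _ => ?_
      rw [← Finset.sum_sub_distrib]
      refine Finset.sum_congr rfl fun r _ => ?_
      ring
    have e2 : (∑ q : Pd k, ∑ r : Pd k, ind U q * ind W r * (if TotDist q r = true then (1:ℤ) else 0) * (1 - ind V (thirdPt q r))) = ntd - mU := by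
      rw [hntd, hmU, ← Finset.sum_sub_distrib]
      refine Finset.sum_congr rfl fun q _ => ?_
      rw [← Finset.sum_sub_distrib]
      refine Finset.sum_congr rfl fun r _ => ?_
      ring
    rw [e1, e2] at h
    exact h
  have hnBp0 : 0 ≤ nBp := by
    rw [hnBp]
    exact Finset.sum_nonneg fun q _ => mul_nonneg (mul_nonneg (ind_nonneg' A0 q) (ind_nonneg' Bp q)) (ind_nonneg' V q)
  -- conclude via the crossed reduction
  refine diagCert_coProduct_N_orTwo_crossed hS hFx hGy hA dS hdS dV hsub (hNV A0 B0 hA0u hB0u) ?_ hP hQ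
  rw [hc1, hc2] at hrow
  linarith [hrow, hinj, hntd_eq, hH1, hH2, hH3, hK]

/-- **COROLLARY (the pattern functional at aligned crossed pairs; every `k`).**  With (T) for `dS`, `d_V` and the box `dS ≤ 8·1_S` in addition:
`0 ≤ sStarD ((x∨y) × (↑a ∪ ↑b)) P Q` at every aligned crossed pair. [this work] -/
theorem sStarD_blockAnd_orTwo_crossed_aligned_nonneg (hS : ∀ ξ η : Pd 1, glue ξ η ∈ S ↔ (1 ≤ ξ 0 ∨ 1 ≤ η 0))
    (hFx : ∀ ξ η : Pd 1, glue ξ η ∈ Fx ↔ 1 ≤ ξ 0) (hGy : ∀ ξ η : Pd 1, glue ξ η ∈ Gy ↔ 1 ≤ η 0)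
    (hA : ∀ σ z, glue σ z ∈ A ↔ (σ ∈ S ∧ z ∈ V))
    (dS : Pd (1 + 1) → ℤ) (hdS : dS (glue (fun _ => 0) (fun _ => 0)) = 0 ∧ dS (glue (fun _ => 0) (fun _ => 1)) = 4 ∧ dS (glue (fun _ => 0) (fun _ => 2)) = 4 ∧
      dS (glue (fun _ => 1) (fun _ => 0)) = 2 ∧ dS (glue (fun _ => 1) (fun _ => 1)) = 5 ∧ dS (glue (fun _ => 1) (fun _ => 2)) = 5 ∧
      dS (glue (fun _ => 2) (fun _ => 0)) = 2 ∧ dS (glue (fun _ => 2) (fun _ => 1)) = 5 ∧ dS (glue (fun _ => 2) (fun _ => 2)) = 5)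
    (hTS : ∀ W' : Finset (Pd (1 + 1)), IsUpperSet (W' : Set (Pd (1 + 1))) → (∑ ξ ∈ W', dS ξ) ≤ ∑ ξ ∈ W', lamU S ξ)
    (hmS : ∀ ξ : Pd (1 + 1), dS ξ ≤ 2 * (2:ℤ) ^ (1 + 1) * ind S ξ)
    {a b a' β u w : Pd k} {Sx : Finset (Fin k)} (hVm : ∀ q, q ∈ V ↔ (a ≤ q ∨ b ≤ q))
    (haS : ∀ i, i ∉ Sx → a i = 0) (hbS : ∀ i, i ∈ Sx → b i = 0) (haa : a ≤ a') (hbb : b ≤ β)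
    (huS : ∀ i, i ∈ Sx → u i = max (a' i) (β i)) (huS' : ∀ i, i ∉ Sx → u i = 0)
    (hwS : ∀ i, i ∈ Sx → w i = 0) (hwS' : ∀ i, i ∉ Sx → w i = max (a' i) (β i))
    {A0 Bp B0 U W : Finset (Pd k)} (hA0 : ∀ q, q ∈ A0 ↔ a' ≤ q) (hBp : ∀ q, q ∈ Bp ↔ β ≤ q) (hB0 : ∀ q, q ∈ B0 ↔ b ≤ q)
    (hU : ∀ q, q ∈ U ↔ u ≤ q) (hW : ∀ q, q ∈ W ↔ w ≤ q)
    (dV : Pd k → ℤ)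
    (hTV : ∀ W' : Finset (Pd k), IsUpperSet (W' : Set (Pd k)) → (∑ q ∈ W', dV q) ≤ ∑ q ∈ W', lamU V q)
    (hNV : ∀ X X' : Finset (Pd k), IsUpperSet (X : Set (Pd k)) → IsUpperSet (X' : Set (Pd k)) → (∑ q ∈ X, ∑ r ∈ X', thetaVal V q r) ≤ ∑ q ∈ X ∩ X', dV q)
    {P Q : Finset (Pd ((1 + 1) + k))} (hPu : IsUpperSet (P : Set (Pd ((1 + 1) + k)))) (hQu : IsUpperSet (Q : Set (Pd ((1 + 1) + k))))
    (hP : ∀ σ q, glue σ q ∈ P ↔ (σ ∈ Fx ∧ q ∈ A0)) (hQ : ∀ σ q, glue σ q ∈ Q ↔ (q ∈ Bp ∨ (σ ∈ Gy ∧ q ∈ B0))) :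
    0 ≤ sStarD A P Q := by
  rw [sStarD_eq_sum_lamU_sub_sum_thetaVal]
  have hT := diagCert_coProduct_T hA dS dV hTS hTV hmS (isUpperSet_inter_coe hPu hQu)
  have hN := diagCert_coProduct_N_orTwo_crossed_aligned hS hFx hGy hA dS hdS hVm haS hbS haa hbb huS huS' hwS hwS' hA0 hBp hB0 hU hW dV hNV hP hQ
  linarith

end AlignedMain

end Summit.CriticalPhenomena.PercolationContinuityZ3.Theorems.SahiGridPattern
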